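import Literature.Probability.LatticeModels.IntersectionSourceSwitch
import Literature.Probability.LatticeModels.CurrentsDisentangling
import Literature.Probability.LatticeModels.AnnularCovering
import HarnessLib

/-!
# From the intersection-clustering bound to the improved tree diagram bound (Aizenman–Duminil-Copin 2021, §4.1, proof of Theorem 1.3)

Topic `Literature/Probability/LatticeModels`. The two displays of Aizenman–Duminil-Copin 2021,
arXiv:1912.07973, §4.1, "Proof of Theorem 1.3 under the assumption (4.1)" (repeated word for word in
§6.1 for the unconditional proof) derive the improved tree diagram bound from three inputs: the annular
covering Lemma 4.2, the switching lemma, and the intersection-clustering bound (Prop. 4.3 / Prop. 6.1):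

  "Using Lemma 4.2, then the switching lemma, and finally Proposition 4.3, we get
  `P^{xy,zt,∅,∅}[0 < |𝒯| < 2^{δK/5}] ≤ ∑_u P^{xy,zt,∅,∅}[u ∈ 𝒯, M_u(𝒯;𝓛,K) < δK]`
  `= ∑_u (⟨σ_uσ_x⟩⟨σ_uσ_y⟩⟨σ_uσ_z⟩⟨σ_uσ_t⟩/⟨σ_xσ_y⟩⟨σ_zσ_t⟩) P^{ux,uz,uy,ut}[M_u(𝒯;𝓛,K) < δK] ≤ 2^{-δK} ∑_u …`.
  For the larger values of `|𝒯|`, the Markov inequality and the switching lemma give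
  `P^{xy,zt,∅,∅}[|𝒯| ≥ 2^{δK/5}] ≤ 2^{-δK/5} E^{xy,zt,∅,∅}[|𝒯|] = 2^{-δK/5} ∑_u (⟨σ_uσ_x⟩⟨σ_uσ_y⟩⟨σ_uσ_z⟩⟨σ_uσ_t⟩/⟨σ_xσ_y⟩⟨σ_zσ_t⟩)`.
  Adding … gives an improved tree diagram bound"

(`𝒯 = C_{n₁+n₃}(x) ∩ C_{n₂+n₄}(z)`). This file proves the resulting **reduction**, for edge couplings
`K ≥ 0` on a finite simple graph whose vertex type carries a pseudo-metric (the sup-norm metric of a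
box of `ℤ⁴` in the source), in un-normalised current-sum form and *without* the clustering bound as an
input: the clustering probabilities appear on the right-hand side as the masses
`clusteringMass … u = Z[yu]Z[xu]Z[tu]Z[zu] · P^{uy,ux} ⊗ P^{ut,uz}[M_u(C(u) ∩ C'(u); ℓ, K_s) < 7r]`,
to be bounded by whoever proves Prop. 6.1 (the constant `7` is that of the tree's covering lemma
`exists_annulusCount_lt_of_card_lt_two_pow`, `AnnularCovering.lean`, in place of the printed `5`):

* `Current.interInd_le_sum_add_card_div` — the pointwise covering/Markov split
  `𝟙[𝒯 ≠ ∅] ≤ ∑_u 𝟙[u ∈ 𝒯] 𝟙[M_u(𝒯) < 7r] + |𝒯| / 2^r`;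
* `Current.tsum_interWeight_mul_card_eq_treeMass` — `E[|𝒯|]`: `∑ W |𝒯| = ∑_u Z[yu]Z[xu] · Z[tu]Z[zu]`
  (the switching lemma as the three-point identity);
* `Current.tsum_interWeight_mul_interInd_le` — **the reduction**:
  `∑ 1{xy}1{∅}1{zt}1{∅} w⁴ 𝟙[𝒯 ≠ ∅] ≤ ∑_u clusteringMass u + (∑_u Z[yu]Z[xu]Z[tu]Z[zu]) / 2^r`
  for every `r` and every scale sequence (`1 ≤ ℓ₁`, `2ℓ_k ≤ ℓ_{k+1}`);
* `Current.ursellInter_mul_sq_le` — combined with the disentangling bound (3.13)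
  (`CurrentsDisentangling.lean`): `Z[∅]² · P ≤ ∑_u clusteringMass u + treeMass / 2^r` for the
  intersection term `P = ∑ 1{xy}1{zt} w w 𝟙[z ∈ C(x)]` of `U₄` (`Current.ursellFour_currentSum_identity`:
  `U₄ · Z[∅]² = -2P` after normalisation), i.e.
  `|U₄(x,y,z,t)| ≤ 2 ∑_u (⟨σ_uσ_x⟩⟨σ_uσ_y⟩⟨σ_uσ_z⟩⟨σ_uσ_t⟩) (P^{ux,uz,uy,ut}[M_u < 7r] + 2^{-r})`.

With Prop. 6.1 (`P^{ux,uz,uy,ut}[M_u(𝒯;𝓛,K) < δK] ≤ 2^{-δK}`, `K ≥ c log B_L(β)`) this is Theorem 1.3;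
that input, the choice of scales and the passage to `ℤ⁴`/infinite volume are not part of this file. No
named fact is introduced; everything is proved.

## References

* M. Aizenman, H. Duminil-Copin, Ann. of Math. 194 (2021), arXiv:1912.07973, §4.1, proof of Thm 1.3
  (the two displays and "Adding … gives an improved tree diagram bound"), §6.1 (unconditional version)
  [AizenmanDuminilCopinAnnals2021].
-/

noncomputable section

open Finset Filter
open scoped symmDiff ENNReal

namespace Literature.Probability.LatticeModels

variable {V : Type*} [Fintype V] [DecidableEq V] {G : SimpleGraph V} [DecidableRel G.Adj]

namespace Current

variable {K : G.edgeFinset → ℝ}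

/-! ### The objects -/

/-- The weight of the four currents `P^{xy,∅} ⊗ P^{zt,∅}` (un-normalised):
`W(p,q) = 1{∂p₁={x,y}}1{∂p₂=∅} w w · 1{∂q₁={z,t}}1{∂q₂=∅} w w`, `p = (n₁,n₃)`, `q = (n₂,n₄)`.
[cite: AizenmanDuminilCopinAnnals2021, arXiv:1912.07973 §3.2, the measure P^{xy,zt,∅,∅} of (3.14)] -/
def interWeight (K : G.edgeFinset → ℝ) (x y z t : V) (pq : (Current G × Current G) × (Current G × Current G)) :
    ℝ≥0∞ :=
  epairWeight K ({x} ∆ {y}) ∅ pq.1 * epairWeight K ({z} ∆ {t}) ∅ pq.2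

/-- The intersection set `𝒯 = C_{n₁+n₃}(x) ∩ C_{n₂+n₄}(z)` of Aizenman–Duminil-Copin 2021, §4.1.
[cite: AizenmanDuminilCopinAnnals2021, arXiv:1912.07973 §4.1, definition of 𝒯] -/
def interSet (x z : V) (pq : (Current G × Current G) × (Current G × Current G)) : Finset V :=
  (pq.1.1 + pq.1.2).cluster x ∩ (pq.2.1 + pq.2.2).cluster z

/-- The indicator `𝟙[𝒯 ≠ ∅]`. [folklore] -/
def interInd (x z : V) (pq : (Current G × Current G) × (Current G × Current G)) : ℝ≥0∞ :=
  if interSet x z pq = ∅ then 0 else 1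

/-- The tree-diagram mass `∑_u Z[yu]Z[xu] · Z[tu]Z[zu]`
(`= Z[xy]Z[zt]Z[∅]² ∑_u ⟨σ_uσ_x⟩⟨σ_uσ_y⟩⟨σ_uσ_z⟩⟨σ_uσ_t⟩/(⟨σ_xσ_y⟩⟨σ_zσ_t⟩) = Z[xy]Z[zt]Z[∅]² E[|𝒯|]`).
[cite: AizenmanDuminilCopinAnnals2021, arXiv:1912.07973 §4.1, proof of Thm 1.3 (E[|𝒯|])] -/
def treeMass (K : G.edgeFinset → ℝ) (x y z t : V) : ℝ≥0∞ :=
  ∑ u, ecurrentSum K ({y} ∆ {u}) * ecurrentSum K ({x} ∆ {u}) *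
    (ecurrentSum K ({t} ∆ {u}) * ecurrentSum K ({z} ∆ {u}))

/-- The clustering mass at `u`: the un-normalised probability, under the rerouted four currents
`P^{uy,ux} ⊗ P^{ut,uz}` (`= P^{ux,uz,uy,ut}`), that the intersection of the two clusters of `u` meets
fewer than `7r` annuli around `u`:
`∑ 1{yu}1{xu}1{tu}1{zu} w⁴ 𝟙[M_u(C_{n₁+n₃}(u) ∩ C_{n₂+n₄}(u); ℓ, K_s) < 7r]` — the quantity the
intersection-clustering bound (ADC Prop. 4.3 / 6.1) controls.
[cite: AizenmanDuminilCopinAnnals2021, arXiv:1912.07973 §4.1, Prop. 4.3 and §6.1, Prop. 6.1 (the event M_u(𝒯;𝓛,K) < δK)] -/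
def clusteringMass [PseudoMetricSpace V] (K : G.edgeFinset → ℝ) (ℓ : ℕ → ℕ) (Ks r : ℕ) (x y z t u : V) :
    ℝ≥0∞ :=
  ∑' pq : (Current G × Current G) × (Current G × Current G),
    epairWeight K ({y} ∆ {u}) ({x} ∆ {u}) pq.1 * epairWeight K ({t} ∆ {u}) ({z} ∆ {u}) pq.2 *
      (if annulusCount ℓ Ks ((pq.1.1 + pq.1.2).cluster u ∩ (pq.2.1 + pq.2.2).cluster u) u < 7 * r
        then 1 else 0)

/-! ### `|𝒯|` as a sum of connection indicators -/

/-- `𝟙[u ∈ C_p(x)] 𝟙[u ∈ C_q(z)] = 𝟙[u ∈ 𝒯]`. [folklore] -/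
theorem connInd_mul_connInd_eq (x z u : V) (pq : (Current G × Current G) × (Current G × Current G)) :
    connInd u x pq.1 * connInd u z pq.2 = if u ∈ interSet x z pq then 1 else 0 := by
  unfold connInd interSet
  by_cases h1 : u ∈ (pq.1.1 + pq.1.2).cluster x <;> by_cases h2 : u ∈ (pq.2.1 + pq.2.2).cluster z <;>
    simp [h1, h2, Finset.mem_inter]

/-- `∑_u 𝟙[u ∈ C_p(x)] 𝟙[u ∈ C_q(z)] = |𝒯|`. [folklore] -/
theorem sum_connInd_mul_connInd_eq_card (x z : V) (pq : (Current G × Current G) × (Current G × Current G)) :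
    ∑ u, connInd u x pq.1 * connInd u z pq.2 = (#(interSet x z pq) : ℝ≥0∞) := by
  simp_rw [connInd_mul_connInd_eq]
  rw [Finset.sum_boole]
  congr 1
  congr 1
  ext u
  simp

/-! ### The pointwise covering/Markov split -/

/-- **The covering/Markov split** (Aizenman–Duminil-Copin 2021, §4.1, the first inequality of the
first display and the Markov step of the second): for every configuration,
`𝟙[𝒯 ≠ ∅] ≤ ∑_u 𝟙[u ∈ C_p(x)]𝟙[u ∈ C_q(z)] 𝟙[M_u(𝒯; ℓ, K_s) < 7r] + |𝒯|/2^r` — if `0 < |𝒯| < 2^r`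
the covering lemma gives a `u ∈ 𝒯` with `M_u(𝒯) < 7r`, otherwise `|𝒯| ≥ 2^r`.
[cite: AizenmanDuminilCopinAnnals2021, arXiv:1912.07973 §4.1, proof of Thm 1.3 ("Using Lemma 4.2 …" and "the Markov inequality")] -/
theorem interInd_le_sum_add_card_div [PseudoMetricSpace V] {ℓ : ℕ → ℕ} (h1 : 1 ≤ ℓ 1)
    (h2 : ∀ k, 2 * ℓ k ≤ ℓ (k + 1)) (Ks r : ℕ) (x z : V)
    (pq : (Current G × Current G) × (Current G × Current G)) :
    interInd x z pq ≤
      (∑ u, connInd u x pq.1 * connInd u z pq.2 *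
        (if annulusCount ℓ Ks (interSet x z pq) u < 7 * r then 1 else 0)) +
        (#(interSet x z pq) : ℝ≥0∞) / 2 ^ r := by
  unfold interInd
  by_cases he : interSet x z pq = ∅
  · rw [if_pos he]; exact bot_le
  rw [if_neg he]
  have hne : (interSet x z pq).Nonempty := Finset.nonempty_iff_ne_empty.2 he
  by_cases hc : #(interSet x z pq) < 2 ^ r
  · -- covering lemma: some `u ∈ 𝒯` has `M_u(𝒯) < 7r`
    obtain ⟨u, hu, hlt⟩ := exists_annulusCount_lt_of_card_lt_two_pow h1 h2 Ks hne hc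
    refine le_add_right ?_
    refine le_trans (le_of_eq ?_) (Finset.single_le_sum (f := fun u => connInd u x pq.1 * connInd u z pq.2 *
      (if annulusCount ℓ Ks (interSet x z pq) u < 7 * r then 1 else 0)) (fun _ _ => bot_le) (Finset.mem_univ u))
    rw [connInd_mul_connInd_eq, if_pos hu, if_pos hlt, one_mul]
  · -- Markov: `|𝒯| ≥ 2^r`
    refine le_add_left ?_
    rw [ENNReal.le_div_iff_mul_le (Or.inl (pow_ne_zero r two_ne_zero)) (Or.inl (ENNReal.pow_ne_top ENNReal.ofNat_ne_top)),
      one_mul]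
    exact_mod_cast not_lt.1 hc

/-! ### The first moment `E[|𝒯|]` -/

/-- **`E[|𝒯|]` is the tree diagram** (Aizenman–Duminil-Copin 2021, §4.1:
"`E^{xy,zt,∅,∅}[|𝒯|] = ∑_u ⟨σ_uσ_x⟩⟨σ_uσ_y⟩⟨σ_uσ_z⟩⟨σ_uσ_t⟩/(⟨σ_xσ_y⟩⟨σ_zσ_t⟩)`" by the switching
lemma), un-normalised: `∑ W |𝒯| = ∑_u Z[yu]Z[xu] · Z[tu]Z[zu]`.
[cite: AizenmanDuminilCopinAnnals2021, arXiv:1912.07973 §4.1, proof of Thm 1.3 (E[|𝒯|] and the switching lemma)] -/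
theorem tsum_interWeight_mul_card_eq_treeMass (hK : ∀ e, 0 ≤ K e) (x y z t : V) :
    ∑' pq, interWeight K x y z t pq * (#(interSet x z pq) : ℝ≥0∞) = treeMass K x y z t := by
  simp_rw [← sum_connInd_mul_connInd_eq_card, Finset.mul_sum]
  rw [Summable.tsum_finsetSum (fun _ _ => ENNReal.summable)]
  refine Finset.sum_congr rfl fun u _ => ?_
  have h : ∀ pq : (Current G × Current G) × (Current G × Current G),
      interWeight K x y z t pq * (connInd u x pq.1 * connInd u z pq.2) =
        (epairWeight K ({x} ∆ {y}) ∅ pq.1 * connInd u x pq.1) *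
          (epairWeight K ({z} ∆ {t}) ∅ pq.2 * connInd u z pq.2) := fun pq => by
    unfold interWeight; ring
  rw [tsum_congr h, ← tsum_mul_tsum_eq_tsum_prod (fun p => epairWeight K ({x} ∆ {y}) ∅ p * connInd u x p)
    (fun q => epairWeight K ({z} ∆ {t}) ∅ q * connInd u z q)]
  unfold connInd
  rw [tsum_epairWeight_mul_indicator_mem_cluster hK x y u, tsum_epairWeight_mul_indicator_mem_cluster hK z t u]

/-! ### The reduction -/

/-- **The intersection mass is controlled by the clustering masses and the tree diagram**
(Aizenman–Duminil-Copin 2021, §4.1, the two displays of the proof of Thm 1.3 added up), for `K ≥ 0`,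
any scale sequence `1 ≤ ℓ₁`, `2ℓ_k ≤ ℓ_{k+1}`, any `K_s` and `r`:
`∑ 1{xy}1{∅}1{zt}1{∅} w⁴ 𝟙[𝒯 ≠ ∅] ≤ ∑_u clusteringMass u + (∑_u Z[yu]Z[xu]Z[tu]Z[zu]) / 2^r`, i.e.
`P^{xy,zt,∅,∅}[𝒯 ≠ ∅] ≤ ∑_u (⟨σ_uσ_x⟩⟨σ_uσ_y⟩⟨σ_uσ_z⟩⟨σ_uσ_t⟩/⟨σ_xσ_y⟩⟨σ_zσ_t⟩)(P^{ux,uz,uy,ut}[M_u(𝒯) < 7r] + 2^{-r})`.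
[cite: AizenmanDuminilCopinAnnals2021, arXiv:1912.07973 §4.1, proof of Thm 1.3 (the two displays, "Adding …")] -/
theorem tsum_interWeight_mul_interInd_le [PseudoMetricSpace V] (hK : ∀ e, 0 ≤ K e) {ℓ : ℕ → ℕ}
    (h1 : 1 ≤ ℓ 1) (h2 : ∀ k, 2 * ℓ k ≤ ℓ (k + 1)) (Ks r : ℕ) (x y z t : V) :
    ∑' pq, interWeight K x y z t pq * interInd x z pq ≤
      (∑ u, clusteringMass K ℓ Ks r x y z t u) + treeMass K x y z t / 2 ^ r := by
  calc ∑' pq, interWeight K x y z t pq * interInd x z pq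
      ≤ ∑' pq, interWeight K x y z t pq *
          ((∑ u, connInd u x pq.1 * connInd u z pq.2 *
            (if annulusCount ℓ Ks (interSet x z pq) u < 7 * r then 1 else 0)) +
            (#(interSet x z pq) : ℝ≥0∞) / 2 ^ r) :=
        ENNReal.tsum_le_tsum fun pq => mul_le_mul' le_rfl (interInd_le_sum_add_card_div h1 h2 Ks r x z pq)
    _ = (∑ u, ∑' pq, interWeight K x y z t pq * (connInd u x pq.1 * connInd u z pq.2 *
            (if annulusCount ℓ Ks (interSet x z pq) u < 7 * r then 1 else 0))) +
          (∑' pq, interWeight K x y z t pq * (#(interSet x z pq) : ℝ≥0∞)) / 2 ^ r := by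
        simp_rw [mul_add, Finset.mul_sum]
        rw [ENNReal.tsum_add, Summable.tsum_finsetSum (fun _ _ => ENNReal.summable), div_eq_mul_inv,
          ← ENNReal.tsum_mul_right]
        congr 1
        exact tsum_congr fun pq => by rw [div_eq_mul_inv, mul_assoc]
    _ = (∑ u, clusteringMass K ℓ Ks r x y z t u) + treeMass K x y z t / 2 ^ r := by
        rw [tsum_interWeight_mul_card_eq_treeMass hK]
        congr 1
        refine Finset.sum_congr rfl fun u _ => ?_
        unfold clusteringMass interWeight interSet
        exact tsum_prod_inter_mul_eq_switch_cluster hK x y z t u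
          (fun S₁ S₂ => if annulusCount ℓ Ks (S₁ ∩ S₂) u < 7 * r then 1 else 0)

/-- **The improved tree diagram bound, reduced to the clustering bound** (Aizenman–Duminil-Copin 2021,
§4.1 with §3.2 (3.12)–(3.14)): for `K ≥ 0`, any scale sequence and any `r`, the intersection term
`P = ∑ 1{∂n₁=xy}1{∂n₂=zt} w w 𝟙[z ∈ C_{n₁+n₂}(x)]` of the random-current identity for `U₄`
(`Current.ursellFour_currentSum_identity`, `U₄ = -2P/Z[∅]²` after normalisation) satisfies
`Z[∅]² P ≤ ∑_u clusteringMass u + (∑_u Z[yu]Z[xu]Z[tu]Z[zu]) / 2^r`, i.e.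
`|U₄(x,y,z,t)| ≤ 2 ∑_u ⟨σ_uσ_x⟩⟨σ_uσ_y⟩⟨σ_uσ_z⟩⟨σ_uσ_t⟩ (P^{ux,uz,uy,ut}[M_u(𝒯;ℓ,K_s) < 7r] + 2^{-r})`.
[cite: AizenmanDuminilCopinAnnals2021, arXiv:1912.07973 §4.1, proof of Thm 1.3] -/
theorem ursellInter_mul_sq_le [PseudoMetricSpace V] (hK : ∀ e, 0 ≤ K e) {ℓ : ℕ → ℕ} (h1 : 1 ≤ ℓ 1)
    (h2 : ∀ k, 2 * ℓ k ≤ ℓ (k + 1)) (Ks r : ℕ) (x y z t : V) :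
    (∑' p, epairWeight K ({x} ∆ {y}) ({z} ∆ {t}) p * (if z ∈ (p.1 + p.2).cluster x then 1 else 0)) *
        ecurrentSum K ∅ ^ 2 ≤
      (∑ u, clusteringMass K ℓ Ks r x y z t u) + treeMass K x y z t / 2 ^ r := by
  refine (tsum_inter_pair_mul_sq_le_four hK x y z t).trans ?_
  refine le_trans (le_of_eq ?_) (tsum_interWeight_mul_interInd_le hK h1 h2 Ks r x y z t)
  conv_rhs => rw [ENNReal.tsum_prod']
  refine tsum_congr fun p => tsum_congr fun q => ?_
  show _ = epairWeight K ({x} ∆ {y}) ∅ p * epairWeight K ({z} ∆ {t}) ∅ q *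
    (if (p.1 + p.2).cluster x ∩ (q.1 + q.2).cluster z = ∅ then 0 else 1)
  by_cases hd : Disjoint ((q.1 + q.2).cluster z) ((p.1 + p.2).cluster x)
  · have he : (p.1 + p.2).cluster x ∩ (q.1 + q.2).cluster z = ∅ := by
      rw [Finset.inter_comm]; exact Finset.disjoint_iff_inter_eq_empty.1 hd
    rw [if_pos hd, if_pos he]
  · have he : (p.1 + p.2).cluster x ∩ (q.1 + q.2).cluster z ≠ ∅ := fun he =>
      hd (Finset.disjoint_iff_inter_eq_empty.2 (by rw [Finset.inter_comm]; exact he))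
    rw [if_neg hd, if_neg he]

end Current

end Literature.Probability.LatticeModels
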